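import Summits.BirchSwinnertonDyer.BirchSwinnertonDyer.Theorems.CyclotomicUntwistCompanionShapeLaw
import Summits.BirchSwinnertonDyer.Rank1Residual.O5.NonSplitAtThreeLawHolds
import Summits.BirchSwinnertonDyer.Rank1Residual.Additive.SelectorIdentityTameThreeHolds
import HarnessLib

/-!
# The P-SHAPE-PARTNER law on the TAME cell (t′) at `3` (Kodaira III / III*): the reducible-local half
# of O5 G3-2 `FlatMemberLawThree` is a theorem
# (route `CyclotomicUntwist` seat `bsd-line-cycu-p2` g5, O6/O5 lane V10 supply; cell `bsd-wall`;
# THEOREMS ONLY — the node `O5.FlatMemberLawThree` itself, whose `LocIrr` rows need the level-2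
# fundamental characters of inertia, is NOT discharged)

`O5/O5CompanionTransport.lean` §2 types `@[conjecture] FlatMemberLawThree`: an O5b curve `W`
(`ClassO5 W 3`, `SubTprime W 3` = Kodaira III/III* at `3`) with `ρ̄_{W,3}` irreducible, not congruent
to its `χ₋₃`-twist, and with a SEMISTABLE companion `G` at `3`, is the III* member: `v₃(Δ) = 9`. Its
docstring splits the mechanism: LocIrr rows (formal parameter over `ℚ₃^{nr}(3^{1/4})`) / reducible-local
rows ("through T18′ / `NonSplitAtThreeLaw`"). The reducible-local rows are settled here by the
P-SHAPE-PARTNER law (`companionShape_of_equivariant`, `…CompanionShapeLaw.lean`):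

* `existsUnique_stableLine_of_tame_of_not_locIrr` — (t′) and `¬ LocIrr W 3` ⟹ exactly one stable line
  (a root by E89, at most one by `O5.nonSplitAtThreeLaw_holds`);
* `padicValRat_c₆_of_tame_of_not_locIrr` — then `v₃(c₆) = 3` on III and `= 6` on III* (selector
  identity `locIrr_three_iff_seven_le_of_subTprime`: reducible iff `v₃(j − 1728) = 2v₃(c₆) − v₃(Δ) = 3`);
* `shapeEtSideThree_of_kodairaIII_of_not_locIrr` / `shapeOrdSideThree_of_kodairaIIIstar_of_not_locIrr`
  — `v₃F(x₀) = v₃(c₆) − 3` (x11b3-p8) is `0` (EVEN: ET-side) on III and `3` (ODD: ORD-side) on III*;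
* `not_equivariant_semistable_of_kodairaIII_of_not_locIrr` — a reducible-local Kodaira-III curve has
  NO `Gal(ℚ̄/ℚ)`-equivariant `G[3] ≃+ W[3]` with `9 ∤ N_G`;
* **`flatMemberLawThree_of_not_locIrr`** — the node's conclusion `padicValRat 3 W.Δ = 9` under the
  node's binders PLUS `¬ LocIrr W 3` (and WITHOUT the non-self-twist hypothesis);
* `lFunction_three_eq_neg_one_iff_of_equivariant` — on any one-stable-line curve the partner's sign:
  `c₃(G) ≡ −1 (mod 3)` iff the unit part of `c₆(W)` is `≡ 1 (mod 3)`.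

HONEST FRAMING: helper theorems; `FlatMemberLawThree` stays `@[conjecture]` (LocIrr half open here);
nothing about any particular curve is asserted; no mark moves; BSD is not proved for any curve.
References: [Serre1972] §1.11; [SilvermanATAEC1994] IV.9.4 Steps 4, 9; [DarmonDiamondTaylor1995] Prop. 2.6(b).
-/

set_option linter.dupNamespace false

noncomputable section

open scoped Classical

namespace Summit.BirchSwinnertonDyer.BirchSwinnertonDyer.Theorems.CompanionShape

open Polynomial WeierstrassCurve Literature.NumberTheory.EllipticCurves
  Literature.NumberTheory.EllipticCurves.Rank1Residual
  Summit.BirchSwinnertonDyer.Rank1Residual.Additive Summit.BirchSwinnertonDyer.Rank1Residual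

section Tame

variable (W : WeierstrassCurve ℚ) [W.IsElliptic] [W.IsGloballyMinimal]

/-- **(t′) and reducible-local ⟹ exactly one stable line** (a `ℚ₃`-root of `Ψ₃` exists by E89 and is
unique by `O5.NonSplitAtThreeLaw`). [cite: Cremona1997, §3.8 (l = 3)] [cite: SilvermanATAEC1994, IV.9.4 Steps 4 and 9] -/
theorem existsUnique_stableLine_of_tame_of_not_locIrr
    (hK : W.kodairaSymbolAt (placeOf 3) = .III ∨ W.kodairaSymbolAt (placeOf 3) = .IIIstar)
    (hred : ¬ LocIrr W 3) : ∃ x₀, IsUniqueStableLineThree W x₀ := by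
  rw [← numStableLinesAtThree_eq_one_iff]
  have hle := O5.numStableLinesAtThree_le_one_of_kodairaSymbolAt_III_or_IIIstar W hK
  have hpos := (O5.not_locIrr_three_iff_numStableLinesAtThree_pos W).mp hred
  omega

/-- **`v₃(c₆) = 3` on reducible-local III, `= 6` on reducible-local III*** (selector identity:
reducible iff `v₃(j − 1728) = 3`, and `v₃(j − 1728) = 2v₃(c₆) − v₃(Δ)` with `v₃(Δ) = 3` resp. `9`).
[cite: SilvermanATAEC1994, IV.9.4 Steps 4 and 9, Table 4.1] -/
theorem padicValRat_c₆_of_tame_of_not_locIrr (hadd : Addv W 3) (hT : SubTprime W 3)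
    (hred : ¬ LocIrr W 3) :
    W.c₆ ≠ 0 ∧ (W.kodairaSymbolAt (placeOf 3) = .III → padicValRat 3 W.c₆ = 3) ∧
      (W.kodairaSymbolAt (placeOf 3) = .IIIstar → padicValRat 3 W.c₆ = 6) := by
  have hK := (subTprime_three_iff_kodairaSymbolAt_III_or_IIIstar (W := W) hadd).mp hT
  obtain ⟨x₀, hx⟩ := existsUnique_stableLine_of_tame_of_not_locIrr W hK hred
  have hc6 : W.c₆ ≠ 0 := (stableLineSignThree_eq_c₆_mul W hx).1
  have hj : W.j ≠ 1728 := by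
    intro hj
    apply hc6
    have hΔ : W.Δ ≠ 0 := by rw [← W.coe_Δ']; exact W.Δ'.ne_zero
    have h := j_sub_eq_c₆_sq_div_Δ W
    rw [hj, sub_self, eq_comm, div_eq_zero_iff] at h
    exact pow_eq_zero_iff two_ne_zero |>.mp (h.resolve_right hΔ)
  have h3 : padicValRat 3 (W.j - 1728) = 3 := by
    have h7 : ¬ 7 ≤ padicValRat 3 (W.j - 1728) :=
      fun h ↦ hred ((locIrr_three_iff_seven_le_of_subTprime W hadd hT hj).mpr h)
    rcases padicValRat_j_sub_eq_three_or_seven_le_of_kodairaSymbolAt_III_or_IIIstar W hK hj with h | h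
    · exact h
    · exact absurd h h7
  rw [padicValRat_j_sub_eq W hc6] at h3
  have hΔ := padicValRat_Δ_eq_of_kodairaSymbolAt_III_or_IIIstar W hK
  refine ⟨hc6, fun h ↦ ?_, fun h ↦ ?_⟩
  · have := hΔ.1 h; omega
  · have := hΔ.2 h; omega

/-- **Reducible-local Kodaira III is ET-side** (`v₃F(x₀) = v₃(c₆) − 3 = 0` is even).
[cite: Serre1972, §1.11] -/
theorem shapeEtSideThree_of_kodairaIII_of_not_locIrr (hadd : Addv W 3) (hT : SubTprime W 3)
    (hred : ¬ LocIrr W 3) (hK : W.kodairaSymbolAt (placeOf 3) = .III) : ShapeEtSideThree W := by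
  obtain ⟨hc6, h3, -⟩ := padicValRat_c₆_of_tame_of_not_locIrr W hadd hT hred
  obtain ⟨x₀, hx⟩ := existsUnique_stableLine_of_tame_of_not_locIrr W (Or.inl hK) hred
  obtain ⟨hne, hv⟩ := valuation_stableLineSignThree W hx
  have hev : Even (stableLineSignThree W x₀).valuation := ⟨0, by rw [hv, h3 hK]; norm_num⟩
  rcases unitPartCongThree_one_or_neg_one hne with h | h
  · exact Or.inl ⟨x₀, hx, hne, hev, h⟩
  · exact Or.inr ⟨x₀, hx, hne, hev, h⟩

/-- **Reducible-local Kodaira III* is ORD-side** (`v₃F(x₀) = 6 − 3 = 3` is odd).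
[cite: Serre1972, §1.11] -/
theorem shapeOrdSideThree_of_kodairaIIIstar_of_not_locIrr (hadd : Addv W 3) (hT : SubTprime W 3)
    (hred : ¬ LocIrr W 3) (hK : W.kodairaSymbolAt (placeOf 3) = .IIIstar) : ShapeOrdSideThree W := by
  obtain ⟨hc6, -, h6⟩ := padicValRat_c₆_of_tame_of_not_locIrr W hadd hT hred
  obtain ⟨x₀, hx⟩ := existsUnique_stableLine_of_tame_of_not_locIrr W (Or.inr hK) hred
  obtain ⟨hne, hv⟩ := valuation_stableLineSignThree W hx
  have hodd : Odd (stableLineSignThree W x₀).valuation := ⟨1, by rw [hv, h6 hK]; norm_num⟩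
  rcases unitPartCongThree_one_or_neg_one hne with h | h
  · exact Or.inr ⟨x₀, hx, hne, hodd, h⟩
  · exact Or.inl ⟨x₀, hx, hne, hodd, h⟩

variable (G : WeierstrassCurve ℚ) [G.IsElliptic] [G.IsGloballyMinimal]

/-- **A reducible-local Kodaira-III curve has no semistable mod-`3` partner**: ET-side rows carry no
`Gal(ℚ̄/ℚ)`-equivariant `G[3] ≃+ W[3]` with `9 ∤ N_G` (P-SHAPE-PARTNER law). [cite: Serre1972, §1.11] -/
theorem not_equivariant_semistable_of_kodairaIII_of_not_locIrr (hadd : Addv W 3) (hT : SubTprime W 3)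
    (hred : ¬ LocIrr W 3) (hK : W.kodairaSymbolAt (placeOf 3) = .III)
    (e : geomTorsion G (3 : ℤ) ≃+ geomTorsion W (3 : ℤ))
    (he : ∀ (σ : Field.absoluteGaloisGroup ℚ) (P : geomTorsion G (3 : ℤ)), e (σ • P) = σ • e P)
    (h9 : ¬ 9 ∣ G.conductorNorm ℤ) : False :=
  (companionShape_of_equivariant W G e he h9).1
    (shapeEtSideThree_of_kodairaIII_of_not_locIrr W hadd hT hred hK)

/-- **`FlatMemberLawThree` on the reducible-local rows.** Under the node's binders (`ClassO5 W 3`,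
`SubTprime W 3`, `ρ̄_{W,3}` irreducible, `O5.IsCompanionAtThree W G`) PLUS `¬ LocIrr W 3`, and WITHOUT the
node's non-self-twist hypothesis: `W` is the Kodaira-III* member, `v₃(Δ) = 9`.
[cite: DarmonDiamondTaylor1995, Prop. 2.6 (b) (PDF p. 53)] [cite: Serre1972, §1.11 Prop. 11] -/
theorem flatMemberLawThree_of_not_locIrr (hO : ClassO5 W 3) (hT : SubTprime W 3)
    (hirr : W.HasIrreducibleModPGaloisRep 3) (hcomp : O5.IsCompanionAtThree W G)
    (hred : ¬ LocIrr W 3) : padicValRat 3 W.Δ = 9 := by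
  have hadd : Addv W 3 := hO.2.1
  have hK := (subTprime_three_iff_kodairaSymbolAt_III_or_IIIstar (W := W) hadd).mp hT
  obtain ⟨e, he⟩ := O5.modThreeTransport_of_isCompanionAtThree W G hirr hcomp
  rcases hK with h3 | h9
  · exact (not_equivariant_semistable_of_kodairaIII_of_not_locIrr W G hadd hT hred h3 e he hcomp.1).elim
  · exact (padicValRat_Δ_eq_of_kodairaSymbolAt_III_or_IIIstar W (Or.inr h9)).2 h9

omit [W.IsGloballyMinimal] in
/-- **The partner's sign on a one-stable-line curve**, in `c₆(W)` currency: along an equivariant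
`G[3] ≃+ W[3]` with `9 ∤ N_G`, `c₃(G) ≡ −1 (mod 3)` iff the unit part of `c₆(W)` is `≡ 1 (mod 3)` (and
otherwise `c₃(G) ≡ +1`). [cite: Serre1972, §1.11 Prop. 11] -/
theorem lFunction_three_eq_neg_one_iff_of_equivariant
    (e : geomTorsion G (3 : ℤ) ≃+ geomTorsion W (3 : ℤ))
    (he : ∀ (σ : Field.absoluteGaloisGroup ℚ) (P : geomTorsion G (3 : ℤ)), e (σ • P) = σ • e P)
    (h9 : ¬ 9 ∣ G.conductorNorm ℤ) {x₀ : ℚ_[3]} (hx : IsUniqueStableLineThree W x₀) :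
    (((G.LFunction 3 : ℤ) : ZMod 3) = -1 ↔ UnitPartCongThree (W.c₆ : ℚ_[3]) 1) ∧
      (((G.LFunction 3 : ℤ) : ZMod 3) = 1 ↔ ¬ UnitPartCongThree (W.c₆ : ℚ_[3]) 1) := by
  obtain ⟨-, hunit, hc₆, hL⟩ := sign_of_equivariant_semistable W G e he h9 hx
  have key : UnitPartCongThree (W.c₆ : ℚ_[3]) 1 ↔ (((integralModelInt G).c₆ : ℤ) : ZMod 3) = 1 := by
    rw [← unitPartCongThree_stableLineSignThree_iff W hx 1, hunit 1, ← Int.cast_one (R := ℚ_[3]),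
      ← Int.cast_sub, Padic.norm_intCast_lt_one_iff, ← ZMod.intCast_zmod_eq_zero_iff_dvd]
    push_cast
    rw [sub_eq_zero]
  have hne : (((integralModelInt G).c₆ : ℤ) : ZMod 3) ≠ 0 := by
    rwa [Ne, ZMod.intCast_zmod_eq_zero_iff_dvd]
  have tri : ∀ c : ZMod 3, c ≠ 0 → ((-c = -1 ↔ c = 1) ∧ (-c = 1 ↔ ¬ c = 1)) := by decide
  rw [hL, key]
  exact tri _ hne

end Tame

end Summit.BirchSwinnertonDyer.BirchSwinnertonDyer.Theorems.CompanionShape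

end
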